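import Mathlib.LinearAlgebra.FreeModule.PID
import Mathlib.LinearAlgebra.Dimension.Constructions
import Mathlib.LinearAlgebra.FiniteDimensional.Basic
import HarnessLib

/-!
# Full sublattices of a free module over a finite product of principal ideal domains are free

Topic `Algebra/Module` (theorems only; no definition, no named fact, no instance).

Let `R = Π i, R i` be a FINITE product of principal ideal domains (e.g. `ℤ_ℓ ⊗_ℤ 𝓞_K ≅ Π_{v ∣ ℓ} 𝓞_{K,v}`,
a finite product of complete discrete valuation rings, for a number field `K` and a rational prime
`ℓ`; or `ℚ_ℓ ⊗_ℚ K ≅ Π_{v ∣ ℓ} K_v`).  Such a ring is not a domain, and a submodule of a free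
`R`-module need not be free (`ℤ × 0 ⊆ ℤ × ℤ`); but a module over `R` is the product of its components
`e_i M` (`e_i` the standard idempotents; [AndersonFuller1992] §7), each a module over the PID `R i`,
and a submodule `X` of the free module `R^κ` which contains `c • R^κ` for a non-zero-divisor `c`
(a «full sublattice») has every component a full-rank submodule of `(R i)^κ`, free of rank `|κ|` by
[Hungerford1974] Ch. IV Thm. 6.1 — so `X` itself is free of rank `|κ|` over `R`, with a basis glued
from bases of the components.  This is the local half of the lattice bookkeeping for Tate modules of
abelian varieties with complex multiplication by `𝓞_K` (`T_ℓ(A₀^r)` is free of rank `r` over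
`ℤ_ℓ ⊗ 𝓞_K`, and an `𝓞_K`-stable lattice `ℓʲ T ⊆ X̂ ⊆ T` is again free of rank `r`): no class group
appears locally.  The identification `ℤ_ℓ ⊗_ℤ 𝓞_K ≅ Π_{v ∣ ℓ} 𝓞_{K,v}` is not used here; the
statements are over an abstract finite product.

## Contents (all proved)

* `PiPID.apply_ne_zero_of_mem_nonZeroDivisors`, `PiPID.mem_nonZeroDivisors_pi_iff` — in a finite
  product of domains the non-zero-divisors are the elements with all components non-zero.
* `PiPID.nonempty_basis_of_smul_mem` — MAIN: for `X ≤ (κ → Π i, R i)` with `c • f ∈ X` for all `f`,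
  `c` with non-zero components, there is a `(Π i, R i)`-basis of `X` indexed by `κ`.
* `PiPID.nonempty_basis_of_smul_mem_of_basis` — the same for a submodule of any free module with a
  finite basis; `PiPID.free_of_smul_mem`, `PiPID.finrank_eq_card_of_smul_mem` — corollaries
  (`Module.Free`, `finrank = |κ|`); `PiPID.nonempty_basis_of_nsmul_mem` — the case `c = N ∈ ℕ`;
  `PiPID.nonempty_basis_of_injective_of_smul_mem_range` — the sandwich form for an abstract module
  `M ↪ F` whose image contains `c • F`.

## References

* [Hungerford1974] T. W. Hungerford, *Algebra*, GTM 73 (1974), Ch. IV Thm. 6.1 (PDF p. 297): a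
  submodule of a free module over a PID is free of rank at most the rank.
* [AndersonFuller1992] F. W. Anderson, K. R. Fuller, *Rings and Categories of Modules*, 2nd ed.,
  GTM 13 (1992), §7 (ring decompositions by central idempotents; modules over a ring direct sum).
-/

set_option autoImplicit false

universe u v w x

namespace Literature.Algebra.Module

namespace PiPID

variable {ι : Type u} [Fintype ι] [DecidableEq ι] {R : ι → Type v} [∀ i, CommRing (R i)]

/-! ## §1 Non-zero-divisors of a finite product of domains -/

omit [Fintype ι] in
/-- In a product of non-trivial rings a non-zero-divisor has non-zero components (if `c i = 0` then
`e_i · c = 0` with `e_i = Pi.single i 1 ≠ 0`). [cite: AndersonFuller1992, §7] -/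
theorem apply_ne_zero_of_mem_nonZeroDivisors [∀ i, Nontrivial (R i)] {c : Π i, R i}
    (hc : c ∈ nonZeroDivisors (Π i, R i)) (i : ι) : c i ≠ 0 := by
  intro h
  have h1 : (Pi.single i (1 : R i) : Π j, R j) * c = 0 := by
    ext j
    rw [Pi.mul_apply, Pi.zero_apply]
    by_cases hj : j = i
    · subst hj; rw [h, mul_zero]
    · rw [Pi.single_eq_of_ne hj, zero_mul]
  have h2 : (Pi.single i (1 : R i) : Π j, R j) = 0 := (mem_nonZeroDivisors_iff_right.mp hc) _ h1
  have h3 := congr_fun h2 i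
  rw [Pi.single_eq_same, Pi.zero_apply] at h3
  exact one_ne_zero h3

omit [Fintype ι] in
/-- In a product of domains the non-zero-divisors are exactly the elements all of whose components
are non-zero. [cite: AndersonFuller1992, §7] -/
theorem mem_nonZeroDivisors_pi_iff [∀ i, IsDomain (R i)] (c : Π i, R i) :
    c ∈ nonZeroDivisors (Π i, R i) ↔ ∀ i, c i ≠ 0 := by
  refine ⟨apply_ne_zero_of_mem_nonZeroDivisors, fun hc => mem_nonZeroDivisors_iff_right.mpr fun x hx => ?_⟩
  ext i
  have hi := congr_fun hx i
  rw [Pi.mul_apply, Pi.zero_apply] at hi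
  exact (mul_eq_zero.mp hi).resolve_right (hc i)

/-! ## §2 Full submodules of `κ → Π i, R i` are free of rank `|κ|` -/

variable [∀ i, IsDomain (R i)] [∀ i, IsPrincipalIdealRing (R i)] {κ : Type w} [Fintype κ]

/-- **A full sublattice of `(Π i, R i)^κ` is free of rank `|κ|`** (`R i` principal ideal domains,
`ι`, `κ` finite).  If a submodule `X ≤ (κ → Π i, R i)` contains `c • f` for every `f`, where
`c : Π i, R i` has all components non-zero (a non-zero-divisor), then `X` has a basis over
`Π i, R i` indexed by `κ`.  Proof: the `i`-th component `X_i ⊆ (κ → R i)` of `X` (image under the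
`Pi.evalRingHom`-semilinear projection) contains `c i • (κ → R i)`, so it is a submodule of FULL
rank of a free module over the PID `R i`, hence free of rank `|κ|` (Hungerford IV.6.1, Mathlib
`Submodule.nonempty_basis_of_pid`); `X` is the set of vectors all of whose components lie in the
`X_i` (glue with the idempotents `e_i`, [AndersonFuller1992] §7), and the glued family
`B k = (b_i k)_i` of the component bases `b_i` is a basis of `X`: coordinates are read component
by component. [cite: Hungerford1974, Ch. IV Thm. 6.1 (PDF p. 297)] [cite: AndersonFuller1992, §7] -/
theorem nonempty_basis_of_smul_mem (X : Submodule (Π i, R i) (κ → Π i, R i)) (c : Π i, R i)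
    (hc : ∀ i, c i ≠ 0) (hX : ∀ f : κ → Π i, R i, c • f ∈ X) :
    Nonempty (Module.Basis κ (Π i, R i) X) := by
  classical
  -- the component projections, semilinear over the evaluations `Π j, R j →+* R i`
  haveI hsurj : ∀ i, RingHomSurjective (Pi.evalRingHom R i) :=
    fun i => ⟨fun r => ⟨Pi.single i r, Pi.single_eq_same i r⟩⟩
  obtain ⟨p, hp⟩ : ∃ p : ∀ i, (κ → Π j, R j) →ₛₗ[Pi.evalRingHom R i] (κ → R i),
      ∀ i f k, p i f k = f k i :=
    ⟨fun i =>
      { toFun := fun f k => f k i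
        map_add' := fun _ _ => rfl
        map_smul' := fun _ _ => rfl }, fun _ _ _ => rfl⟩
  -- the glueing of a family of components
  obtain ⟨glue, hglue⟩ : ∃ glue : (∀ i, κ → R i) → (κ → Π i, R i),
      ∀ y k i, glue y k i = y i k := ⟨fun y k i => y i k, fun _ _ _ => rfl⟩
  have hext : ∀ f g : κ → Π i, R i, (∀ i, p i f = p i g) → f = g := by
    intro f g h
    funext k i
    have := congr_fun (h i) k
    rwa [hp, hp] at this
  have hpglue : ∀ y i, p i (glue y) = y i := fun y i => by
    funext k; rw [hp, hglue]
  have hpsingle_self : ∀ i (f : κ → Π j, R j), p i ((Pi.single i (1 : R i) : Π j, R j) • f) = p i f :=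
    fun i f => by
    funext k
    rw [hp, hp, Pi.smul_apply, smul_eq_mul, Pi.mul_apply, Pi.single_eq_same, one_mul]
  have hpsingle_ne : ∀ i j (f : κ → Π j, R j), j ≠ i →
      p j ((Pi.single i (1 : R i) : Π j, R j) • f) = 0 := fun i j f hji => by
    funext k
    rw [hp, Pi.smul_apply, smul_eq_mul, Pi.mul_apply, Pi.single_eq_of_ne hji, zero_mul,
      Pi.zero_apply]
  -- the components `X_i` of `X`
  set Xi : ∀ i, Submodule (R i) (κ → R i) := fun i => X.map (p i) with hXi
  have hpmem : ∀ (x : κ → Π i, R i), x ∈ X → ∀ i, p i x ∈ Xi i :=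
    fun x hx i => Submodule.mem_map_of_mem hx
  -- a vector all of whose components lie in the `X_i` lies in `X`
  have hmemglue : ∀ y : ∀ i, κ → R i, (∀ i, y i ∈ Xi i) → glue y ∈ X := by
    intro y hy
    have hy' : ∀ i, ∃ x ∈ X, p i x = y i := fun i => Submodule.mem_map.mp (hy i)
    choose x hx hpx using hy'
    have heq : glue y = ∑ i, (Pi.single i (1 : R i) : Π j, R j) • x i := by
      refine hext _ _ fun j => ?_
      rw [hpglue, map_sum, Finset.sum_eq_single j, hpsingle_self, hpx]
      · intro i _ hij
        exact hpsingle_ne i j (x i) (Ne.symm hij)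
      · intro h; exact absurd (Finset.mem_univ j) h
    rw [heq]
    exact Submodule.sum_mem _ fun i _ => Submodule.smul_mem _ _ (hx i)
  -- every component has full rank
  have hci : ∀ i (g : κ → R i), c i • g ∈ Xi i := fun i g => by
    refine Submodule.mem_map.mpr ⟨c • glue (Pi.single i g), hX _, ?_⟩
    rw [LinearMap.map_smulₛₗ, hpglue, Pi.single_eq_same]
    rfl
  have hfull : ∀ i, Module.finrank (R i) (Xi i) = Fintype.card κ := fun i => by
    apply le_antisymm
    · calc Module.finrank (R i) (Xi i) ≤ Module.finrank (R i) (κ → R i) := Submodule.finrank_le _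
        _ = Fintype.card κ := Module.finrank_fintype_fun_eq_card (R i)
    · have hinj : Function.Injective (c i • (LinearMap.id : (κ → R i) →ₗ[R i] (κ → R i))) :=
        fun g g' h => smul_right_injective (κ → R i) (hc i) h
      have hle : LinearMap.range (c i • (LinearMap.id : (κ → R i) →ₗ[R i] (κ → R i))) ≤ Xi i := by
        rintro _ ⟨g, rfl⟩
        exact hci i g
      calc Fintype.card κ = Module.finrank (R i) (κ → R i) := (Module.finrank_fintype_fun_eq_card (R i)).symm
        _ = Module.finrank (R i)
              (LinearMap.range (c i • (LinearMap.id : (κ → R i) →ₗ[R i] (κ → R i)))) :=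
          (LinearMap.finrank_range_of_inj hinj).symm
        _ ≤ Module.finrank (R i) (Xi i) := Submodule.finrank_mono hle
  -- component bases indexed by `κ` (submodules of free modules over a PID are free)
  have hb : ∀ i, Nonempty (Module.Basis κ (R i) (Xi i)) := fun i => by
    obtain ⟨n, ⟨b⟩⟩ := Submodule.nonempty_basis_of_pid (Pi.basisFun (R i) κ) (Xi i)
    have hn : Fintype.card (Fin n) = Fintype.card κ := by
      rw [← Module.finrank_eq_card_basis b, hfull]
    exact ⟨b.reindex (Fintype.equivOfCardEq hn)⟩
  let b : ∀ i, Module.Basis κ (R i) (Xi i) := fun i => (hb i).some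
  -- the glued family
  let B : κ → X := fun k =>
    ⟨glue fun i => ((b i k : Xi i) : κ → R i), hmemglue _ fun i => (b i k).2⟩
  have hpB : ∀ i k, p i ((B k : X) : κ → Π j, R j) = ((b i k : Xi i) : κ → R i) :=
    fun i k => hpglue _ i
  -- coordinates of a combination, read in the `i`-th component
  have hcomb : ∀ (a : κ → Π i, R i) (i : ι),
      p i (((∑ k, a k • B k : X) : κ → Π j, R j)) = ∑ k, a k i • ((b i k : Xi i) : κ → R i) := by
    intro a i
    rw [Submodule.coe_sum, map_sum]
    refine Finset.sum_congr rfl fun k _ => ?_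
    rw [Submodule.coe_smul, LinearMap.map_smulₛₗ, hpB]
    rfl
  -- linear independence
  have hli : LinearIndependent (Π i, R i) B := by
    refine Fintype.linearIndependent_iff.mpr fun a ha k => ?_
    funext i
    have hbi : LinearIndependent (R i) fun k => ((b i k : Xi i) : κ → R i) :=
      (b i).linearIndependent.map' (Xi i).subtype (Submodule.ker_subtype _)
    have h0 : ∑ k, a k i • ((b i k : Xi i) : κ → R i) = 0 := by
      rw [← hcomb, ha, Submodule.coe_zero, map_zero]
    rw [Pi.zero_apply]
    exact Fintype.linearIndependent_iff.mp hbi (fun k => a k i) h0 k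
  -- spanning
  have hsp : ⊤ ≤ Submodule.span (Π i, R i) (Set.range B) := by
    rintro x -
    let a : κ → Π i, R i := fun k i => (b i).repr ⟨p i x, hpmem _ x.2 i⟩ k
    have hx : x = ∑ k, a k • B k := by
      apply Subtype.ext
      refine hext _ _ fun i => ?_
      rw [hcomb]
      have h := congrArg (fun z : Xi i => (z : κ → R i)) ((b i).sum_repr ⟨p i x, hpmem _ x.2 i⟩)
      simp only [Submodule.coe_sum, Submodule.coe_smul] at h
      exact h.symm
    rw [hx]
    exact Submodule.sum_mem _ fun k _ => Submodule.smul_mem _ _ (Submodule.subset_span ⟨k, rfl⟩)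
  exact ⟨Module.Basis.mk hli hsp⟩

/-- **Full sublattices of a free module of finite rank over `Π i, R i` are free of the same rank**:
if `F` has a basis indexed by the finite type `κ` and `X ≤ F` contains `c • F` for some `c` with
non-zero components, then `X` has a basis indexed by `κ` (transport of
`nonempty_basis_of_smul_mem` along the coordinate isomorphism `F ≃ (κ → Π i, R i)`).
[cite: Hungerford1974, Ch. IV Thm. 6.1 (PDF p. 297)] [cite: AndersonFuller1992, §7] -/
theorem nonempty_basis_of_smul_mem_of_basis {F : Type x} [AddCommGroup F] [Module (Π i, R i) F]
    (bF : Module.Basis κ (Π i, R i) F) (X : Submodule (Π i, R i) F) (c : Π i, R i) (hc : ∀ i, c i ≠ 0)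
    (hX : ∀ f : F, c • f ∈ X) : Nonempty (Module.Basis κ (Π i, R i) X) := by
  let e : F ≃ₗ[Π i, R i] (κ → Π i, R i) := bF.equivFun
  have hX' : ∀ f : κ → Π i, R i, c • f ∈ X.map (e : F →ₗ[Π i, R i] (κ → Π i, R i)) := fun f =>
    Submodule.mem_map.mpr ⟨c • e.symm f, hX _, by rw [LinearEquiv.coe_coe, map_smul, e.apply_symm_apply]⟩
  obtain ⟨b⟩ := nonempty_basis_of_smul_mem (X.map (e : F →ₗ[Π i, R i] (κ → Π i, R i))) c hc hX'
  exact ⟨b.map (Submodule.equivMapOfInjective (e : F →ₗ[Π i, R i] (κ → Π i, R i)) e.injective X).symm⟩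

/-- A full sublattice of a free module of finite rank over a finite product of PIDs is a free module.
[cite: Hungerford1974, Ch. IV Thm. 6.1 (PDF p. 297)] -/
theorem free_of_smul_mem {F : Type x} [AddCommGroup F] [Module (Π i, R i) F]
    (bF : Module.Basis κ (Π i, R i) F) (X : Submodule (Π i, R i) F) (c : Π i, R i) (hc : ∀ i, c i ≠ 0)
    (hX : ∀ f : F, c • f ∈ X) : Module.Free (Π i, R i) X := by
  obtain ⟨b⟩ := nonempty_basis_of_smul_mem_of_basis bF X c hc hX
  exact Module.Free.of_basis b

/-- A full sublattice of a free module of rank `|κ|` over a (non-trivial) finite product of PIDs has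
rank `|κ|`. [cite: Hungerford1974, Ch. IV Thm. 6.1 (PDF p. 297)] -/
theorem finrank_eq_card_of_smul_mem [Nonempty ι] {F : Type x} [AddCommGroup F]
    [Module (Π i, R i) F] (bF : Module.Basis κ (Π i, R i) F) (X : Submodule (Π i, R i) F) (c : Π i, R i)
    (hc : ∀ i, c i ≠ 0) (hX : ∀ f : F, c • f ∈ X) :
    Module.finrank (Π i, R i) X = Fintype.card κ := by
  obtain ⟨i₀⟩ := ‹Nonempty ι›
  haveI : Nontrivial (Π i, R i) := Pi.nontrivial_at i₀
  obtain ⟨b⟩ := nonempty_basis_of_smul_mem_of_basis bF X c hc hX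
  exact Module.finrank_eq_card_basis b

/-- The case `c = N`, a natural number non-zero in every factor (e.g. `N = ℓʲ` in
`Π_{v ∣ ℓ} 𝓞_{K,v}`): a submodule of a free module of rank `|κ|` containing `N • F` is free of rank
`|κ|`. [cite: Hungerford1974, Ch. IV Thm. 6.1 (PDF p. 297)] -/
theorem nonempty_basis_of_nsmul_mem {F : Type x} [AddCommGroup F] [Module (Π i, R i) F]
    (bF : Module.Basis κ (Π i, R i) F) (X : Submodule (Π i, R i) F) (N : ℕ) (hN : ∀ i, (N : R i) ≠ 0)
    (hX : ∀ f : F, N • f ∈ X) : Nonempty (Module.Basis κ (Π i, R i) X) :=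
  nonempty_basis_of_smul_mem_of_basis bF X (N : Π i, R i) (fun i => by rw [Pi.natCast_apply]; exact hN i)
    fun f => by rw [Nat.cast_smul_eq_nsmul]; exact hX f

/-- **Sandwich form**: a module `M` over a finite product of PIDs which embeds into a free module `F`
of rank `|κ|` with image containing `c • F` (`c` with non-zero components) is free of rank `|κ|` —
it has a basis indexed by `κ`.  (This is «a finitely generated torsion-free module all of whose
component ranks are `|κ|` is free» in the form met in practice: `M` and `F` span the same
`Frac`-module.) [cite: Hungerford1974, Ch. IV Thm. 6.1 (PDF p. 297)] [cite: AndersonFuller1992, §7] -/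
theorem nonempty_basis_of_injective_of_smul_mem_range {F : Type x} [AddCommGroup F]
    [Module (Π i, R i) F] (bF : Module.Basis κ (Π i, R i) F) {M : Type*} [AddCommGroup M]
    [Module (Π i, R i) M] (j : M →ₗ[Π i, R i] F) (hj : Function.Injective j) (c : Π i, R i)
    (hc : ∀ i, c i ≠ 0) (hM : ∀ f : F, c • f ∈ LinearMap.range j) :
    Nonempty (Module.Basis κ (Π i, R i) M) := by
  obtain ⟨b⟩ := nonempty_basis_of_smul_mem_of_basis bF (LinearMap.range j) c hc hM
  exact ⟨b.map (LinearEquiv.ofInjective j hj).symm⟩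

end PiPID

end Literature.Algebra.Module
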